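import Summits.Ventures.PercRepro.ProfilePointedCircuitClassesStarSharpD0E

/-!
# PercRepro — CASE D0 OF `StarNineSharp`, PART F: AT MOST ONE RESIDUAL DEMAND OF `H` NEEDS ITS C-POINT
(p5, gen 54; `proofs/P5-GM1.md` §81 (c), rule R4b)

With `H` the ON plane through `e, f` (no ON line) and `w₀ ∈ X ∖ H` fixed, two distinct residual demands
`π₁, π₂ ⊆ H ∩ X` whose triples `{w₀} ∪ π_i` fail the R4a condition cannot coexist (`r4_unique`): then
`H ∩ X = π₁ ∪ π₂ = {t₁, t₂, t₃}` with `π₁ = {t₂, t₃}`, `π₂ = {t₁, t₃}`, the complementary pairs `{t_i, w₀′}` are never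
ON demands (`not_on_demand_of_meets_H`), so `ρ({e, f, t_i} + w₀′) ≤ 3` forces `t_i` onto the line `ef`; then
`ρ((X − π_i) + e) = 4`, so residuality gives `f ∈ cl(π_i)`, and `H = {e, f, t₁, t₂, t₃}` collapses to rank `≤ 2`.
-/

open scoped Matroid

namespace PercRepro.Cogirth

open Finset ThmH Skew Shadow Profile

variable {α : Type} [DecidableEq α] {N : Matroid α} [N.Finite]

section StarSharpD0F

variable {b b' : α}

/-- `insert f (insert e {t, w}) = insert w {e, f, t}`. -/
theorem insert_f_insert_e_pair_eq (e f t w : α) :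
    insert f (insert e ({t, w} : Finset α)) = insert w {e, f, t} := by
  ext x; simp only [mem_insert, mem_singleton]; tauto

/-- `insert e {t, w} = insert e {w, t}`. -/
theorem insert_e_pair_comm (e t w : α) : insert e ({t, w} : Finset α) = insert e {w, t} := by
  ext x; simp only [mem_insert, mem_singleton]; tauto

/-- `{e, f, t} ∪ {f, t, t'} = {e, f, t, t'}` as `insert e (insert f {t, t'})`. -/
theorem union_eft_ftt'_eq (e f t t' : α) :
    ({e, f, t} : Finset α) ∪ {f, t, t'} = insert e (insert f {t, t'}) := by
  ext x; simp only [mem_union, mem_insert, mem_singleton]; tauto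

/-- `{f, t} ⊆ {e, f, t} ∩ {f, t, t'}`. -/
theorem pair_ft_subset_inter (e f t t' : α) : ({f, t} : Finset α) ⊆ {e, f, t} ∩ {f, t, t'} := by
  intro x hx; simp only [mem_insert, mem_singleton, mem_inter] at hx ⊢; tauto

/-- `{e, f} ∪ insert e (insert f {t, t'}) = insert e (insert f {t, t'})`. -/
theorem pair_ef_union_eq (e f t t' : α) :
    ({e, f} : Finset α) ∪ insert e (insert f {t, t'}) = insert e (insert f {t, t'}) := by
  ext x; simp only [mem_union, mem_insert, mem_singleton]; tauto

/-- `insert t₁ (insert e (insert f {t₂, t₃}))` contains `{e, f} ∪ {t₁, t₂, t₃}`-shaped sets: `H ⊆` it. -/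
theorem subset_insert_t_of_inter (e f t₁ t₂ t₃ : α) {H X : Finset α} (hHX : H ⊆ insert f (insert e X))
    (hHXsub : H ∩ X ⊆ {t₁, t₂, t₃}) : H ⊆ insert t₁ (insert e (insert f {t₂, t₃})) := by
  intro x hx
  have hx' := hHX hx
  simp only [mem_insert] at hx'
  simp only [mem_insert, mem_singleton]
  rcases hx' with rfl | rfl | hxX
  · exact Or.inr (Or.inr (Or.inl rfl))
  · exact Or.inr (Or.inl rfl)
  · have := hHXsub (mem_inter.2 ⟨hx, hxX⟩)
    simp only [mem_insert, mem_singleton] at this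
    tauto

/-- `{e, t} ⊆ {e, f, t}`. -/
theorem pair_et_subset_eft (e f t : α) : ({e, t} : Finset α) ⊆ {e, f, t} := by
  intro w hw; simp only [mem_insert, mem_singleton] at hw ⊢; tauto

/-- `{t₂, t₃} ∪ {t₁, t₃} ⊆ {t₁, t₂, t₃}`. -/
theorem union_pairs_subset_triple (t₁ t₂ t₃ : α) : ({t₂, t₃} : Finset α) ∪ {t₁, t₃} ⊆ {t₁, t₂, t₃} := by
  intro x hx; simp only [mem_union, mem_insert, mem_singleton] at hx ⊢; tauto

/-- `{e, f} ⊆ {e, f, t}`. -/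
theorem pair_ef_subset_eft (e f t : α) : ({e, f} : Finset α) ⊆ {e, f, t} := by
  intro w hw; simp only [mem_insert, mem_singleton] at hw ⊢; tauto

/-- `{t₁, e, f} = {e, f, t₁}`. -/
theorem triple_rot (e f t₁ : α) : ({t₁, e, f} : Finset α) = {e, f, t₁} := by
  ext x; simp only [mem_insert, mem_singleton]; tauto

/-- **THE R4b DEMAND IS UNIQUE.** -/
theorem r4_unique (h : SeriesPair N b b') (hn : (gr N).card = 9) (hR : rk N (gr N) = 5)
    (hcf : ∀ x ∈ gr N, rk N ((gr N).erase x) = 5) (hE7 : rk N (((gr N).erase b).erase b') = 4)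
    (hnl : ∀ S : Finset α, S ⊆ ((gr N).erase b).erase b' → rk N (insert b (insert b' S)) ≤ 3 → rk N S ≤ 1)
    {e f : α} (he : e ∈ gr N) (hf : f ∈ gr N) (hef : e ≠ f) (heb : e ≠ b) (heb' : e ≠ b') (hfb : f ≠ b) (hfb' : f ≠ b')
    (hef2 : rk N {e, f} = 2)
    (he1 : ∀ y ∈ ((((gr N).erase b).erase b').erase f).erase e, rk N {e, y} = 2)
    (hf1 : ∀ y ∈ ((((gr N).erase b).erase b').erase f).erase e, rk N {f, y} = 2)
    {H : Finset α} (hH : H ⊆ ((gr N).erase b).erase b') (heH : e ∈ H) (hfH : f ∈ H) (hH3 : rk N H = 3)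
    (hHon : rk N (insert b (insert b' H)) = 4)
    (hHfl : ∀ z ∈ ((gr N).erase b).erase b', z ∉ H → rk N (insert z H) = 4)
    {w₀ : α} (hw₀ : w₀ ∈ ((((gr N).erase b).erase b').erase f).erase e) (hw₀H : w₀ ∉ H)
    {π₁ π₂ : Finset α} (hne : π₁ ≠ π₂)
    (hπ₁ : π₁ ⊆ ((((gr N).erase b).erase b').erase f).erase e) (hπ₁2 : π₁.card = 2) (hπ₁H : insert e π₁ ⊆ H)
    (hπ₂ : π₂ ⊆ ((((gr N).erase b).erase b').erase f).erase e) (hπ₂2 : π₂.card = 2) (hπ₂H : insert e π₂ ⊆ H)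
    (hYc₁ : rk N (insert f (((((gr N).erase b).erase b').erase f).erase e \ π₁)) = 4)
    (hYc₂ : rk N (insert f (((((gr N).erase b).erase b').erase f).erase e \ π₂)) = 4)
    (hres₁ : ¬ (rk N (insert f π₁) = 3 ∧ rk N (insert e (((((gr N).erase b).erase b').erase f).erase e \ π₁)) = 4))
    (hres₂ : ¬ (rk N (insert f π₂) = 3 ∧ rk N (insert e (((((gr N).erase b).erase b').erase f).erase e \ π₂)) = 4))
    (hfail₁ : ¬ (rk N (insert f (insert e ((((((gr N).erase b).erase b').erase f).erase e \ π₁).erase w₀))) = 4 ∧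
      ¬ (insert b (insert e ((((((gr N).erase b).erase b').erase f).erase e \ π₁).erase w₀)) ∈ biIndepSets N 4 ∧
        rk N (insert b (insert b' (insert e ((((((gr N).erase b).erase b').erase f).erase e \ π₁).erase w₀)))) = 4)))
    (hfail₂ : ¬ (rk N (insert f (insert e ((((((gr N).erase b).erase b').erase f).erase e \ π₂).erase w₀))) = 4 ∧
      ¬ (insert b (insert e ((((((gr N).erase b).erase b').erase f).erase e \ π₂).erase w₀)) ∈ biIndepSets N 4 ∧
        rk N (insert b (insert b' (insert e ((((((gr N).erase b).erase b').erase f).erase e \ π₂).erase w₀)))) = 4))) :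
    False := by
  set X := ((((gr N).erase b).erase b').erase f).erase e with hXdef
  have hXE : X ⊆ ((gr N).erase b).erase b' := (erase_subset _ _).trans (erase_subset _ _)
  have hXg : X ⊆ gr N := hXE.trans ((erase_subset _ _).trans (erase_subset _ _))
  have hHg : H ⊆ gr N := hH.trans ((erase_subset _ _).trans (erase_subset _ _))
  have heE : e ∈ ((gr N).erase b).erase b' := mem_erase.2 ⟨heb', mem_erase.2 ⟨heb, he⟩⟩
  have hfE : f ∈ ((gr N).erase b).erase b' := mem_erase.2 ⟨hfb', mem_erase.2 ⟨hfb, hf⟩⟩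
  have hE7c : (((gr N).erase b).erase b').card = 7 := by
    rw [card_erase_of_mem (mem_erase.2 ⟨h.2.2.1.symm, h.2.1⟩), card_erase_of_mem h.1, hn]
  have hXc : X.card = 5 := by
    rw [hXdef, card_erase_of_mem (mem_erase.2 ⟨hef, heE⟩), card_erase_of_mem hfE, hE7c]
  have heX : e ∉ X := fun h' => (mem_erase.1 h').1 rfl
  have hfX : f ∉ X := fun h' => (mem_erase.1 (mem_erase.1 h').2).1 rfl
  have hE7eq : ((gr N).erase b).erase b' = insert f (insert e X) := by
    rw [hXdef, insert_erase (mem_erase.2 ⟨hef, heE⟩), insert_erase hfE]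
  -- `H ∩ X` has at most three points
  have hH5 := card_H_le_five h hn hcf hE7 hH hH3 hHon
  have hHX3 : (H ∩ X).card ≤ 3 := by
    have hsub : H ∩ X ⊆ (H.erase e).erase f := by
      intro x hx
      exact mem_erase.2 ⟨fun h' => hfX (h' ▸ (mem_inter.1 hx).2), mem_erase.2 ⟨fun h' => heX (h' ▸ (mem_inter.1 hx).2),
        (mem_inter.1 hx).1⟩⟩
    have := card_le_card hsub
    rw [card_erase_of_mem (mem_erase.2 ⟨hef.symm, hfH⟩), card_erase_of_mem heH] at this
    omega
  -- the three points `t₁, t₂, t₃`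
  have hπ₁X : π₁ ⊆ H ∩ X := fun x hx => mem_inter.2 ⟨hπ₁H (mem_insert_of_mem hx), hπ₁ hx⟩
  have hπ₂X : π₂ ⊆ H ∩ X := fun x hx => mem_inter.2 ⟨hπ₂H (mem_insert_of_mem hx), hπ₂ hx⟩
  have hcap := card_union_add_card_inter π₁ π₂
  have hU3 : (π₁ ∪ π₂).card ≤ 3 := (card_le_card (union_subset hπ₁X hπ₂X)).trans hHX3
  have hI1 : (π₁ ∩ π₂).card = 1 := by
    have hle : (π₁ ∩ π₂).card ≤ 2 := (card_le_card inter_subset_left).trans hπ₁2.le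
    have hne2 : (π₁ ∩ π₂).card ≠ 2 := by
      intro h2
      have h3 : π₁ ∩ π₂ = π₁ := eq_of_subset_of_card_le inter_subset_left (by omega)
      have h4 : π₁ ∩ π₂ = π₂ := eq_of_subset_of_card_le inter_subset_right (by omega)
      exact hne (h3.symm.trans h4)
    omega
  obtain ⟨t₃, ht₃⟩ := card_eq_one.1 hI1
  have hd1 : (π₂ \ π₁).card = 1 := by
    have := card_sdiff_add_card_inter π₂ π₁
    rw [inter_comm, hI1, hπ₂2] at this; omega
  have hd2 : (π₁ \ π₂).card = 1 := by
    have := card_sdiff_add_card_inter π₁ π₂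
    rw [hI1, hπ₁2] at this; omega
  obtain ⟨t₁, ht₁⟩ := card_eq_one.1 hd1
  obtain ⟨t₂, ht₂⟩ := card_eq_one.1 hd2
  have ht₃π₁ : t₃ ∈ π₁ := (mem_inter.1 (ht₃ ▸ mem_singleton_self t₃)).1
  have ht₃π₂ : t₃ ∈ π₂ := (mem_inter.1 (ht₃ ▸ mem_singleton_self t₃)).2
  have ht₁π₂ : t₁ ∈ π₂ := (mem_sdiff.1 (ht₁ ▸ mem_singleton_self t₁)).1
  have ht₁π₁ : t₁ ∉ π₁ := (mem_sdiff.1 (ht₁ ▸ mem_singleton_self t₁)).2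
  have ht₂π₁ : t₂ ∈ π₁ := (mem_sdiff.1 (ht₂ ▸ mem_singleton_self t₂)).1
  have ht₂π₂ : t₂ ∉ π₂ := (mem_sdiff.1 (ht₂ ▸ mem_singleton_self t₂)).2
  have hπ₁eq : π₁ = {t₂, t₃} := by
    rw [← sdiff_union_inter π₁ π₂, ht₂, ht₃]; rfl
  have hπ₂eq : π₂ = {t₁, t₃} := by
    rw [← sdiff_union_inter π₂ π₁, ht₁, inter_comm, ht₃]; rfl
  have ht₁₃ : t₁ ≠ t₃ := fun h' => ht₁π₁ (h' ▸ ht₃π₁)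
  have ht₂₃ : t₂ ≠ t₃ := fun h' => ht₂π₂ (h' ▸ ht₃π₂)
  have ht₁X : t₁ ∈ X := hπ₂ ht₁π₂
  have ht₂X : t₂ ∈ X := hπ₁ ht₂π₁
  have ht₃X : t₃ ∈ X := hπ₁ ht₃π₁
  have ht₁H : t₁ ∈ H := hπ₂H (mem_insert_of_mem ht₁π₂)
  have ht₂H : t₂ ∈ H := hπ₁H (mem_insert_of_mem ht₂π₁)
  have ht₃H : t₃ ∈ H := hπ₁H (mem_insert_of_mem ht₃π₁)
  -- `H ∩ X = π₁ ∪ π₂` and the second point `w₀′` of `X ∖ H`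
  have hU3' : (π₁ ∪ π₂).card = 3 := by omega
  have hHXeq : H ∩ X = π₁ ∪ π₂ :=
    (eq_of_subset_of_card_le (union_subset hπ₁X hπ₂X) (by omega)).symm
  have hw₀π : w₀ ∉ π₁ ∪ π₂ := fun h' => hw₀H (mem_inter.1 (hHXeq ▸ h' : w₀ ∈ H ∩ X)).1
  have hc2 : (X \ (π₁ ∪ π₂)).card = 2 := by
    rw [card_sdiff_of_subset (union_subset hπ₁ hπ₂), hXc, hU3']
  have hc1 : ((X \ (π₁ ∪ π₂)).erase w₀).card = 1 := by
    rw [card_erase_of_mem (mem_sdiff.2 ⟨hw₀, hw₀π⟩), hc2]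
  obtain ⟨w₀', hw₀'⟩ := card_eq_one.1 hc1
  have hw₀'mem : w₀' ∈ (X \ (π₁ ∪ π₂)).erase w₀ := hw₀' ▸ mem_singleton_self w₀'
  have hw₀'X : w₀' ∈ X := (mem_sdiff.1 (mem_of_mem_erase hw₀'mem)).1
  have hw₀'π : w₀' ∉ π₁ ∪ π₂ := (mem_sdiff.1 (mem_of_mem_erase hw₀'mem)).2
  have hw₀'w₀ : w₀' ≠ w₀ := (mem_erase.1 hw₀'mem).1
  have hw₀'H : w₀' ∉ H := fun h' => hw₀'π (hHXeq ▸ mem_inter.2 ⟨h', hw₀'X⟩)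
  -- the complementary pairs
  have hcomp : ∀ (π t : Finset α) (tt : α), π ⊆ X → tt ∈ X → tt ∉ π → (π ∪ t = π₁ ∪ π₂) → t = {tt} →
      (X \ π).erase w₀ = {tt, w₀'} := by
    intro π t tt hπX httX httπ hUt ht
    ext x
    simp only [mem_erase, mem_sdiff, mem_insert, mem_singleton]
    constructor
    · rintro ⟨hxw₀, hxX, hxπ⟩
      by_cases hxU : x ∈ π₁ ∪ π₂
      · rw [← hUt, mem_union] at hxU
        rcases hxU with hxπ' | hxt
        · exact absurd hxπ' hxπ
        · rw [ht, mem_singleton] at hxt; exact Or.inl hxt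
      · have : x ∈ (X \ (π₁ ∪ π₂)).erase w₀ := mem_erase.2 ⟨hxw₀, mem_sdiff.2 ⟨hxX, hxU⟩⟩
        rw [hw₀', mem_singleton] at this; exact Or.inr this
    · rintro (rfl | rfl)
      · refine ⟨fun h' => hw₀π ?_, httX, httπ⟩
        rw [← hUt, ← h']; exact mem_union_right _ (ht ▸ mem_singleton_self _)
      · refine ⟨hw₀'w₀, hw₀'X, fun h' => hw₀'π ?_⟩
        rw [← hUt]; exact mem_union_left _ h'
  have hcomp₁ : (X \ π₁).erase w₀ = {t₁, w₀'} := hcomp π₁ (π₂ \ π₁) t₁ hπ₁ ht₁X ht₁π₁ (by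
    rw [union_sdiff_self_eq_union]) ht₁
  have hcomp₂ : (X \ π₂).erase w₀ = {t₂, w₀'} := hcomp π₂ (π₁ \ π₂) t₂ hπ₂ ht₂X ht₂π₂ (by
    rw [union_sdiff_self_eq_union, union_comm]) ht₂
  -- the third points lie on the line `ef`
  have hline : ∀ (π : Finset α) (t : α), t ∈ X → t ∈ H → (X \ π).erase w₀ = {t, w₀'} →
      ¬ (rk N (insert f (insert e ((X \ π).erase w₀))) = 4 ∧
        ¬ (insert b (insert e ((X \ π).erase w₀)) ∈ biIndepSets N 4 ∧
          rk N (insert b (insert b' (insert e ((X \ π).erase w₀)))) = 4)) → rk N {e, f, t} ≤ 2 := by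
    intro π t htX htH hcomp hfail
    rw [hcomp] at hfail
    have hnod := not_on_demand_of_meets_H h hn hR hE7 hnl he heb heb' he1 hH heH hHon hHfl htX htH hw₀'X hw₀'H
    rw [← insert_e_pair_comm] at hnod
    have h4 : rk N (insert f (insert e {t, w₀'})) ≠ 4 := fun h' => hfail ⟨h', hnod⟩
    rw [insert_f_insert_e_pair_eq] at h4
    have hefts : ({e, f, t} : Finset α) ⊆ H := by
      intro x hx; simp only [mem_insert, mem_singleton] at hx
      rcases hx with rfl | rfl | rfl <;> assumption
    have h5 := rk_insert_eq_add_one_of_subset_flat (N := N) (hXg hw₀'X) hHg hefts (by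
      rw [hHfl w₀' (hXE hw₀'X) hw₀'H, hH3])
    have h6 : rk N {e, f, t} ≤ 3 := by
      have := rk_le_card' (M := N) {e, f, t}
      have hc : ({e, f, t} : Finset α).card ≤ 3 := by
        refine (card_insert_le _ _).trans ?_
        refine Nat.succ_le_succ ?_
        exact (card_insert_le _ _).trans (by rw [card_singleton])
      omega
    omega
  have ht₁l := hline π₁ t₁ ht₁X ht₁H hcomp₁ hfail₁
  have ht₂l := hline π₂ t₂ ht₂X ht₂H hcomp₂ hfail₂
  -- residuality gives `f ∈ cl(π_i)`
  have hclf : ∀ (π : Finset α) (t : α), t ∈ X → t ∉ π → insert e π ⊆ H → rk N {e, f, t} ≤ 2 →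
      rk N (insert f (X \ π)) = 4 →
      ¬ (rk N (insert f π) = 3 ∧ rk N (insert e (X \ π)) = 4) → rk N (insert f π) ≤ 2 := by
    intro π t htX htπ hπH hefT hYc hres
    have h1 : rk N (insert f {e, t}) = rk N {e, t} := by
      have := he1 t htX
      have e1 : insert f ({e, t} : Finset α) = {f, e, t} := rfl
      have hm : rk N {e, t} ≤ rk N {e, f, t} := rk_mono' (M := N) (pair_et_subset_eft e f t)
      rw [e1, triple_swap12]; omega
    have h2 : rk N (insert f ({e, t} ∪ (X \ π))) = rk N ({e, t} ∪ (X \ π)) := rk_insert_union_eq_of_rk_insert_eq' h1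
    have e2 : ({e, t} : Finset α) ∪ (X \ π) = insert e (X \ π) := by
      ext x; simp only [mem_union, mem_insert, mem_singleton, mem_sdiff]
      constructor
      · rintro ((rfl | rfl) | hx)
        · exact Or.inl rfl
        · exact Or.inr ⟨htX, htπ⟩
        · exact Or.inr hx
      · rintro (rfl | hx)
        · exact Or.inl (Or.inl rfl)
        · exact Or.inr hx
    rw [e2] at h2
    have h3 : rk N (insert f (X \ π)) ≤ rk N (insert f (insert e (X \ π))) :=
      rk_mono' (M := N) (insert_subset_insert f (subset_insert e _))
    have h4 : rk N (insert e (X \ π)) ≤ 4 := by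
      have := rk_mono' (M := N) (show insert e (X \ π) ⊆ ((gr N).erase b).erase b' from
        insert_subset heE (sdiff_subset.trans hXE))
      omega
    have h5 : rk N (insert e (X \ π)) = 4 := by omega
    have h6 : rk N (insert f π) ≠ 3 := fun h' => hres ⟨h', h5⟩
    have h7 : rk N (insert f π) ≤ 3 := by
      have := rk_mono' (M := N) (show insert f π ⊆ H from insert_subset hfH ((subset_insert e π).trans hπH))
      omega
    omega
  have hf₁ : rk N (insert f π₁) ≤ 2 := hclf π₁ t₁ ht₁X ht₁π₁ hπ₁H ht₁l hYc₁ hres₁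
  have hf₂ : rk N (insert f π₂) ≤ 2 := hclf π₂ t₂ ht₂X ht₂π₂ hπ₂H ht₂l hYc₂ hres₂
  -- `H` collapses: `{e, f, t₂} ∪ {f, t₂, t₃}` has rank `≤ 2`, and `t₁ ∈ cl{e, f}`
  have hft₂ : rk N {f, t₂} = 2 := hf1 t₂ ht₂X
  have hA : rk N ({e, f, t₂} ∪ {f, t₂, t₃}) ≤ 2 :=
    rk_union_le_two_of_pair (pair_ft_subset_inter e f t₂ t₃) hft₂ ht₂l (by rw [hπ₁eq] at hf₁; exact hf₁)
  rw [union_eft_ftt'_eq] at hA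
  have hB : rk N (insert t₁ ({e, f} ∪ insert e (insert f {t₂, t₃}))) = rk N ({e, f} ∪ insert e (insert f {t₂, t₃})) := by
    apply rk_insert_union_eq_of_rk_insert_eq'
    have hm : rk N {e, f} ≤ rk N {e, f, t₁} := rk_mono' (M := N) (pair_ef_subset_eft e f t₁)
    have e1 : insert t₁ ({e, f} : Finset α) = {t₁, e, f} := rfl
    rw [e1, triple_rot]; omega
  rw [pair_ef_union_eq] at hB
  have hHsub : H ⊆ insert t₁ (insert e (insert f {t₂, t₃})) := by
    apply subset_insert_t_of_inter e f t₁ t₂ t₃ (hE7eq ▸ hH)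
    rw [hHXeq, hπ₁eq, hπ₂eq]
    exact union_pairs_subset_triple t₁ t₂ t₃
  have hHle : rk N H ≤ rk N (insert t₁ (insert e (insert f {t₂, t₃}))) := rk_mono' (M := N) hHsub
  omega

end StarSharpD0F

end PercRepro.Cogirth
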